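import Literature.NumberTheory.ComplexMultiplication.FiniteQAlgebraLatticeMetricDual
import Mathlib.LinearAlgebra.Dual.Lemmas
import HarnessLib

/-!
# FADDEEV'S CRITERION FOR AN ARBITRARY finite-dimensional commutative `ℚ`-algebra `A`: a full lattice `L` is
# invertible iff `𝒪(𝒪(L):L) = 𝒪(L)` (Hertling–Larabi 2026 Thm. 5.6 (c) (i) ⟺ (v) [Fa65] = Hertling–Larabi 2026b
# Thm. 4.3 (b) (i) ⟺ (iv)) — the printed proof through the DUAL SPACE `A^* = Hom_ℚ(A, ℚ)` and Krull's lemma for a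
# lattice of `A^*`

[topic NumberTheory/ComplexMultiplication] General-`A` series (namespace
`Literature.NumberTheory.ComplexMultiplication.FiniteQAlgebraLattice`), sequel of `FiniteQAlgebraLatticeMetricDual`
(the same theorem for an `A` with a multiplicative metric, i.e. Gorenstein `A`) and of
`FiniteQAlgebraLatticeMaximalOrderInvertible` (reduced `A`, by transport from `Y = ∏ Lᵢ`).  Here NO hypothesis on `A`:
nilpotents allowed, `A` need not be Gorenstein (e.g. `ℚ[x,y]/(x,y)²`).  Lane `lit-hodgefound` (Track 2 foundations
library), seat p19 generation 36, row g36-#3.  THEOREMS ONLY: no definition, no instance, no notation, no named fact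
(D-0026, net Literature debt `0`), no `sorry`.  The dual space is Mathlib's `Module.Dual ℚ A`; the dual lattice
`L^{*ℤ}` of the source enters only through `ℤ`-bases: for `L = ⊕ ℤbᵢ` it is `⊕ ℤbᵢ^*` on the dual basis
(`Module.Basis.dualBasis`), so no new definition is needed; the `A`-action `β^*(a, C) = C(a·)` on `A^*` is
`C ∘ₗ LinearMap.mulLeft ℚ a`, and `(V^*)^* = V` is `Module.evalEquiv`.

## Source, VERBATIM

C. Hertling, K. Larabi, *Semigroups from full lattices in commutative ℚ-algebras*, arXiv:2602.14973 (2026)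
[HertlingLarabi2026], held `paper:arxiv-2602.14973`.  §2 (chunk p0005): «**Definition 2.1.** […] (b) The dual space
of `V` is denoted `V^* := Hom_ℚ(V, ℚ)`. For each subset `M ⊂ V` define `M^{*ℤ} := {C ∈ V^* | C(m) ∈ ℤ for all m ∈ M}
⊂ V^*`. […] **Lemma 2.2.** […] (b) `(V^*)^* = V`. If `L` is a lattice in `V` then `(L^{*ℤ})^{*ℤ} = L`. Furthermore then
`L^{*ℤ}` is a full lattice in `V^*` if and only if `L` is a full lattice in `V`. […] **Lemma 2.3.** […] (b) A dual
bilinear map `β^*` is defined by `β^* : V_1 × V_3^* → V_2^*`, `β^*(a, C)(b) := C(β(a, b))` […]. Then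
`(L_3 : L_1)^{*ℤ} = β^*(L_1, L_3^{*ℤ})`, equivalently: `L_3 : L_1 = (β^*(L_1, L_3^{*ℤ}))^{*ℤ}`.»
§5 (chunk p0011): «**Lemma 5.2.** […] (c) (Krull's lemma, [DTZ62]) Let `Λ` and `L` be full lattices in `A` with
`Λ·Λ ⊂ Λ` and `Λ·L = L`. Then `1_A ∈ Λ`, so `Λ` is an order. […] Proof: (c) Choose a ℤ-basis `(b_1, ..., b_n)` of
`L`. Because of `L = Λ·L`, there are `a_{ij} ∈ Λ` […] with `(b_1, ..., b_n) = (b_1, ..., b_n)·(a_{ij})`, so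
`0 = (b_1, ..., b_n)·(δ_{ij} − a_{ij})`. Multiplying from the right with the adjoint of the matrix `(δ_{ij} − a_{ij})`,
we obtain `b_k·det(δ_{ij} − a_{ij}) = 0`, so `A·det(δ_{ij} − a_{ij}) = 0`, so `det(δ_{ij} − a_{ij}) = 0`. Because of
`Λ·Λ ⊂ Λ`, all products of the `a_{ij}` are in `Λ`, so also `1_A ∈ Λ`. □»
§5 (chunk p0012): «**Theorem 5.6 (DTZ62).** [Fa65] […] (c) Let `L ∈ 𝓛(A)`. The following five properties are
equivalent: (i) `L` is invertible in the semigroup `𝓛(A)`. (ii) `L_2 ∈ 𝓛(A)` with `L·L_2 = 𝒪(L)` exists.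
(iii) `L·(𝒪(L):L) = 𝒪(L)`. (iv) `[L]_ε` is invertible in the semigroup `𝓔(A)`. (v) `𝒪(𝒪(L):L) = 𝒪(L)`. If this holds
then `e_L = 𝒪(L)`, `L⁻¹ = 𝒪(L):L`, `L⁻¹` is invertible with `𝒪(L⁻¹) = 𝒪(L)` […] (v)⟹(i): We will apply Lemma 2.3
with `(V_1, V_2, V_3, β, L_1, L_3) = (A, A, A, multiplication, L(𝒪(L):L), 𝒪(L))`. We will write `β^* : A × A^* → A^*`
also as multiplication. We will show `L_1² ⊂ L_1` (5.6), `L_1·L_3^{*ℤ} = L_3^{*ℤ}` (5.7). A variant of Krull's lemma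
Lemma 5.2 (c) with the lattice `L_3^{*ℤ} ∈ 𝓛(A^*)` instead of a full lattice in `A` works and shows
`1_A ∈ L_1 = L(𝒪(L):L)`, so `L_1 = 𝒪(L)`, so `L` is invertible. (5.6) follows from
`L_1² = (L(𝒪(L):L))² ⊂ 𝒪(L)·L(𝒪(L):L) = L(𝒪(L):L) = L_1`. (5.7) is by Lemma 2.3 (b) equivalent to `L_3 : L_1 = L_3`
(5.8). This is proved as follows. Consider `a ∈ L_3 : L_1 = 𝒪(L):(L(𝒪(L):L))`. `L(𝒪(L):L)a ⊂ 𝒪(L)`, so `(𝒪(L):L)a`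
maps `L` to `𝒪(L)`, so `(𝒪(L):L)a ⊂ 𝒪(L):L`, so `a ∈ 𝒪(𝒪(L):L) = 𝒪(L)` (here (v) is used), so
`𝒪(L):(L(𝒪(L):L)) = 𝒪(L)`. The implication (v)⟹(i) is proved. □» («The equivalence (i)⟺(v) in Theorem 5.6 (c)
is not in [DTZ62], but in [Fa65]. Though the proof below of (i)⟺(v) is not given in [Fa65].»)

C. Hertling, K. Larabi, *Conjugacy classes of regular integer matrices*, arXiv:2602.15748 (2026)
[HertlingLarabi2026b], §4 (chunk p0007): «**Theorem 4.3 (DTZ62).** [Fa65-1] [HL26] […] (b) Let `L ∈ 𝓛(A)`. The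
following four properties are equivalent: (i) `L` is invertible in the semigroup `𝓛(A)`. (ii) `L_2 ∈ 𝓛(A)` with
`L·L_2 = 𝒪(L)` exists. (iii) `L·(𝒪(L):L) = 𝒪(L)`. (iv) `𝒪(𝒪(L):L) = 𝒪(L)`. If this holds then `e_L = 𝒪(L)`,
`L⁻¹ = 𝒪(L):L`, and `L⁻¹` is invertible with `𝒪(L⁻¹) = 𝒪(L)`.»

## What is formalised (`M`, `Λ : Submodule ℤ A`; `N : Submodule ℤ (Module.Dual ℚ A)`; `𝒪(M) = M / M`)

* §1 DEFINITION 2.1 (b) ∕ LEMMA 2.2 (b) on a basis: for a `ℚ`-basis `b` of a vector space `V`, a functional `C` takes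
  integer values on `⊕ ℤbᵢ` iff `C ∈ ⊕ ℤbᵢ^*` (**`mem_span_dualBasis_iff`**), i.e. `(⊕ ℤbᵢ)^{*ℤ} = ⊕ ℤbᵢ^*`; and
  `v ∈ ⊕ ℤbᵢ ⟺ bᵢ^*(v) ∈ ℤ ∀ i` (`mem_span_iff_forall_dualBasis`).
* §2 KRULL'S LEMMA WITH A LATTICE OF `A^*` («a variant of Krull's lemma Lemma 5.2 (c) with the lattice
  `L_3^{*ℤ} ∈ 𝓛(A^*)`»): if `ΛΛ ⊆ Λ`, `N ⊂ A^*` is finitely generated, `Λ`-stable and FAITHFUL (`C(r·) = 0 ∀ C ∈ N`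
  only for `r = 0`), and `N ⊆ Λ·N := ℤ⟨C(a·) | a ∈ Λ, C ∈ N⟩`, then `1_A ∈ Λ`
  (**`one_mem_of_mul_le_of_le_span_comp_mulLeft`**; Nakayama over `ℤ·1 + Λ` acting on `A^*` by precomposition).
* §3 **THEOREM 5.6 (c) (v) ⟹ (iii) FOR EVERY `A`** (**`mul_div_div_eq_of_div_div_div_eq_of_isFullLattice`**): (5.6),
  (5.8) in `𝓛(A)`; `L_3^{*ℤ} = ⊕ ℤbᵢ^*` for a `ℤ`-basis `b` of `𝒪(L)`; `K = L_1·L_3^{*ℤ}` is a full lattice of `A^*`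
  (`k·L_3^{*ℤ} ⊆ K ⊆ L_3^{*ℤ}` with `k·1_A ∈ L_1`), on whose predual vectors `vᵢ = (b'ᵢ)^*` (`Module.evalEquiv`) both
  `K` and `L_3^{*ℤ}` are tested, giving (5.7) `L_3^{*ℤ} ⊆ K` from (5.8); then §2.  With the easy (iii) ⟹ (v)
  (`FiniteQAlgebraLattice.div_div_div_eq_of_mul_div_div_eq`): **`mul_div_div_eq_iff_div_div_div_eq_of_isFullLattice`**;
  (ii) ⟺ (iii) `exists_mul_eq_div_self_iff_mul_div_div_eq`; and «`L⁻¹` is invertible with `𝒪(L⁻¹) = 𝒪(L)`»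
  (`div_div_mul_div_div_div_eq_of_mul_div_div_eq`).
NOT here: (iv) (the `ε`-class semigroup `𝓔(A)`), Theorem 5.6 (a)(b) for general `A` (Thm. 5.6 (a) «idempotents are
orders» is `one_mem_of_mul_le_of_mul_eq` of `FiniteQAlgebraLatticeMetricDual` with `L = Λ`).

## References
* [HertlingLarabi2026] C. Hertling, K. Larabi, arXiv:2602.14973 (2026), §2 Def. 2.1 (b), Lemma 2.2 (b), Lemma 2.3 (b)
  (chunk p0005); §5 Lemma 5.2 (c) (chunk p0011), Thm. 5.6 (c) with the proof of (v) ⟹ (i) (chunk p0012).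
  [cite: HertlingLarabi2026, §5 Thm. 5.6 (c) (v) ⟹ (i), chunk p0012]
* [Faddeev1965] D. K. Faddeev, Trudy Mat. Inst. Steklov 80 (1965) 145–182 (= [Fa65] ∕ [Fa65-1]: the equivalence
  (i) ⟺ (v), as cited). [cite: Faddeev1965, as cited by HertlingLarabi2026 Thm. 5.6 (c)]
* [HertlingLarabi2026b] C. Hertling, K. Larabi, arXiv:2602.15748 (2026), §4 Thm. 4.3 (b) (chunk p0007).
  [cite: HertlingLarabi2026b, §4 Thm. 4.3 (b), chunk p0007]
* [DadeTausskyZassenhaus1962] E. C. Dade, O. Taussky, H. Zassenhaus, Math. Ann. 148 (1962) 31–64 (Krull's lemma;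
  «(DTZ62)»). [cite: DadeTausskyZassenhaus1962, §1 (as cited by HertlingLarabi2026 Lemma 5.2 (c))]
-/

noncomputable section

open scoped Pointwise
open Submodule Module
open Literature.NumberTheory.Automorphic (IsFullLattice)

namespace Literature.NumberTheory.ComplexMultiplication.FiniteQAlgebraLattice

/-! ## §1 `L^{*ℤ}` on a basis: `(⊕ ℤbᵢ)^{*ℤ} = ⊕ ℤbᵢ^*` (Definition 2.1 (b), Lemma 2.2 (b)) -/

section DualBasis

variable {V : Type*} [AddCommGroup V] [Module ℚ V] {ι : Type*} [Fintype ι] [DecidableEq ι]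

omit [Fintype ι] [DecidableEq ι] in
/-- Integers form a subring: membership in the image of `ℤ → ℚ` as a set and as a subring. [folklore] -/
private theorem mem_range_iff_mem_rangeS' {q : ℚ} :
    q ∈ Set.range (algebraMap ℤ ℚ) ↔ q ∈ (algebraMap ℤ ℚ).range :=
  ⟨fun ⟨z, hz⟩ => RingHom.mem_range.2 ⟨z, hz⟩, fun h => RingHom.mem_range.1 h⟩

/-- **DEFINITION 2.1 (b) ∕ LEMMA 2.2 (b) on a basis: `(⊕ᵢ ℤbᵢ)^{*ℤ} = ⊕ᵢ ℤbᵢ^*`** — a functional `C ∈ V^*` takes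
integer values on the full lattice `L = ⊕ ℤbᵢ` of a `ℚ`-basis `b` iff `C` is an integer combination of the dual
basis («`M^{*ℤ} := {C ∈ V^* | C(m) ∈ ℤ for all m ∈ M}`»; «`L^{*ℤ}` is a full lattice in `V^*`»).
[cite: HertlingLarabi2026, §2 Def. 2.1 (b) and Lemma 2.2 (b), chunk p0005] -/
theorem mem_span_dualBasis_iff (b : Basis ι ℚ V) (C : Module.Dual ℚ V) :
    C ∈ span ℤ (Set.range b.dualBasis) ↔ ∀ x ∈ span ℤ (Set.range b), ∃ z : ℤ, (z : ℚ) = C x := by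
  constructor
  · intro hC x hx
    -- `C(x) = Σ xᵢ C(bᵢ)` with `xᵢ, C(bᵢ) ∈ ℤ`
    have hCi : ∀ i, C (b i) ∈ (algebraMap ℤ ℚ).range := fun i => by
      obtain ⟨z, hz⟩ := (Basis.mem_span_iff_repr_mem ℤ b.dualBasis C).1 hC i
      exact RingHom.mem_range.2 ⟨z, by rw [hz, Basis.dualBasis_repr]⟩
    have hxi : ∀ i, b.repr x i ∈ (algebraMap ℤ ℚ).range := fun i =>
      mem_range_iff_mem_rangeS'.1 ((Basis.mem_span_iff_repr_mem ℤ b x).1 hx i)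
    have hsum : C x = ∑ i, b.repr x i * C (b i) := by
      conv_lhs => rw [← b.sum_repr x]
      rw [map_sum]
      exact Finset.sum_congr rfl fun i _ => by rw [map_smul, smul_eq_mul]
    obtain ⟨z, hz⟩ := RingHom.mem_range.1 (hsum ▸ Subring.sum_mem _ fun i _ => mul_mem (hxi i) (hCi i) :
      C x ∈ (algebraMap ℤ ℚ).range)
    exact ⟨z, by rw [← hz, eq_intCast]⟩
  · intro h
    refine (Basis.mem_span_iff_repr_mem ℤ b.dualBasis C).2 fun i => ?_
    obtain ⟨z, hz⟩ := h (b i) (Submodule.subset_span (Set.mem_range_self i))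
    exact ⟨z, by rw [Basis.dualBasis_repr, ← hz, eq_intCast]⟩

/-- **LEMMA 2.2 (b), `(L^{*ℤ})^{*ℤ} = L` on a basis: `v ∈ ⊕ ℤbᵢ ⟺ bᵢ^*(v) ∈ ℤ` for all `i`** (the coordinates of `v`
are the values of the dual basis). [cite: HertlingLarabi2026, §2 Lemma 2.2 (b), chunk p0005] -/
theorem mem_span_iff_forall_dualBasis (b : Basis ι ℚ V) (v : V) :
    v ∈ span ℤ (Set.range b) ↔ ∀ i, ∃ z : ℤ, (z : ℚ) = b.dualBasis i v := by
  rw [Basis.mem_span_iff_repr_mem]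
  refine forall_congr' fun i => ?_
  rw [Basis.dualBasis_apply]
  exact ⟨fun ⟨z, hz⟩ => ⟨z, by rw [← hz, eq_intCast]⟩, fun ⟨z, hz⟩ => ⟨z, by rw [eq_intCast, hz]⟩⟩

end DualBasis

variable {A : Type} [CommRing A] [Algebra ℚ A]

/-! ## §2 Krull's lemma with a lattice of the dual space `A^*` -/

/-- **«A VARIANT OF KRULL'S LEMMA Lemma 5.2 (c) with the lattice `L_3^{*ℤ} ∈ 𝓛(A^*)` instead of a full lattice in `A`»:
if `ΛΛ ⊆ Λ` and a finitely generated, `Λ`-stable, faithful `N ⊂ A^*` satisfies `N ⊆ Λ·N = ℤ⟨C(a·) | a ∈ Λ, C ∈ N⟩`,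
then `1_A ∈ Λ`** — the determinant trick of the printed proof as Nakayama's lemma for the ideal `Λ` of the
commutative ring `ℤ·1 + Λ = Algebra.adjoin ℤ Λ`, acting on `A^*` through `β^*(a, C) = C(a·)`: some `r ≡ 1 (mod Λ)`
acts as zero on `N`, faithfulness gives `r = 0`, so `1 ∈ Λ`.
[cite: HertlingLarabi2026, §5 Lemma 5.2 (c) and Thm. 5.6 (c) proof of (v) ⟹ (i), chunks p0011–p0012] [cite: DadeTausskyZassenhaus1962, §1 (Krull's lemma, as cited)] -/
theorem one_mem_of_mul_le_of_le_span_comp_mulLeft {Λ : Submodule ℤ A} (hΛ : Λ * Λ ≤ Λ)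
    {N : Submodule ℤ (Module.Dual ℚ A)} (hN : N.FG)
    (hfaith : ∀ r : A, (∀ C ∈ N, C ∘ₗ LinearMap.mulLeft ℚ r = 0) → r = 0)
    (hstab : ∀ a ∈ Λ, ∀ C ∈ N, C ∘ₗ LinearMap.mulLeft ℚ a ∈ N)
    (hΛN : N ≤ span ℤ {D : Module.Dual ℚ A | ∃ a ∈ Λ, ∃ C ∈ N, D = C ∘ₗ LinearMap.mulLeft ℚ a}) :
    (1 : A) ∈ Λ := by
  -- the ring `R = ℤ·1 + Λ` and its ideal `Λ`
  let S : Subalgebra ℤ A := Algebra.adjoin ℤ (Λ : Set A)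
  -- `R` acts on `A^*` by precomposition with multiplication
  letI : Module S (Module.Dual ℚ A) :=
    { smul := fun r C => C ∘ₗ LinearMap.mulLeft ℚ (r : A)
      one_smul := fun C => LinearMap.ext fun x => by
        change C (((1 : S) : A) * x) = C x
        rw [OneMemClass.coe_one, one_mul]
      mul_smul := fun r s C => LinearMap.ext fun x => by
        change C (((r * s : S) : A) * x) = C ((s : A) * ((r : A) * x))
        rw [MulMemClass.coe_mul, mul_assoc, mul_left_comm]
      smul_zero := fun r => LinearMap.ext fun x => by
        change (0 : Module.Dual ℚ A) ((r : A) * x) = 0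
        rw [LinearMap.zero_apply]
      smul_add := fun r C D => LinearMap.ext fun x => by
        change (C + D) ((r : A) * x) = C ((r : A) * x) + D ((r : A) * x)
        rw [LinearMap.add_apply]
      add_smul := fun r s C => LinearMap.ext fun x => by
        change C (((r + s : S) : A) * x) = C ((r : A) * x) + C ((s : A) * x)
        rw [AddMemClass.coe_add, add_mul, map_add]
      zero_smul := fun C => LinearMap.ext fun x => by
        change C (((0 : S) : A) * x) = 0
        rw [ZeroMemClass.coe_zero, zero_mul, map_zero] }
  have hsmul : ∀ (r : S) (C : Module.Dual ℚ A), r • C = C ∘ₗ LinearMap.mulLeft ℚ (r : A) := fun _ _ => rfl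
  have hstab' : ∀ r ∈ S, (∀ a ∈ Λ, r * a ∈ Λ) ∧ ∀ C ∈ N, C ∘ₗ LinearMap.mulLeft ℚ r ∈ N := by
    intro r hr
    refine Algebra.adjoin_induction (fun x hx => ⟨fun a ha => hΛ (Submodule.mul_mem_mul hx ha), fun C hC => ?_⟩)
      (fun k => ⟨fun a ha => ?_, fun C hC => ?_⟩) (fun x y _ _ hx hy => ⟨fun a ha => ?_, fun C hC => ?_⟩)
      (fun x y _ _ hx hy => ⟨fun a ha => ?_, fun C hC => ?_⟩) hr
    · exact hstab x hx C hC
    · rw [Algebra.algebraMap_eq_smul_one, smul_mul_assoc, one_mul]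
      exact Λ.smul_mem k ha
    · have e : C ∘ₗ LinearMap.mulLeft ℚ (algebraMap ℤ A k) = k • C := LinearMap.ext fun x => by
        rw [LinearMap.comp_apply, LinearMap.mulLeft_apply, Algebra.algebraMap_eq_smul_one, smul_mul_assoc, one_mul,
          map_zsmul, LinearMap.smul_apply]
      rw [e]
      exact N.smul_mem k hC
    · rw [add_mul]; exact Λ.add_mem (hx.1 a ha) (hy.1 a ha)
    · have e : C ∘ₗ LinearMap.mulLeft ℚ (x + y) = C ∘ₗ LinearMap.mulLeft ℚ x + C ∘ₗ LinearMap.mulLeft ℚ y :=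
        LinearMap.ext fun z => by
          simp only [LinearMap.comp_apply, LinearMap.mulLeft_apply, LinearMap.add_apply, add_mul, map_add]
      rw [e]
      exact N.add_mem (hx.2 C hC) (hy.2 C hC)
    · rw [mul_assoc]; exact hx.1 _ (hy.1 a ha)
    · rw [LinearMap.mulLeft_mul, ← LinearMap.comp_assoc]
      exact hy.2 _ (hx.2 C hC)
  let I : Ideal S :=
    { carrier := {r | (r : A) ∈ Λ}
      add_mem' := fun {a b} ha hb => by
        change ((a : A) + b) ∈ Λ
        exact Λ.add_mem ha hb
      zero_mem' := Λ.zero_mem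
      smul_mem' := fun r a ha => by
        change ((r : A) * a) ∈ Λ
        exact (hstab' r r.2).1 _ ha }
  let N' : Submodule S (Module.Dual ℚ A) :=
    { carrier := N
      add_mem' := fun ha hb => N.add_mem ha hb
      zero_mem' := N.zero_mem
      smul_mem' := fun r C hC => by
        change C ∘ₗ LinearMap.mulLeft ℚ (r : A) ∈ N
        exact (hstab' r r.2).2 C hC }
  -- `N` is finitely generated over `S` and `N ≤ I • N`
  have hNfg : N'.FG := by
    obtain ⟨s, hs⟩ := hN
    refine ⟨s, le_antisymm (Submodule.span_le.2 fun x hx => ?_) fun x hx => ?_⟩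
    · change x ∈ N
      rw [← hs]
      exact Submodule.subset_span hx
    · have hx' : x ∈ span ℤ (s : Set (Module.Dual ℚ A)) := by rw [hs]; exact hx
      exact Submodule.span_le_restrictScalars ℤ S (s : Set (Module.Dual ℚ A)) hx'
  have hIN : N' ≤ I • N' := by
    intro C hC
    refine Submodule.span_induction (p := fun D _ => D ∈ I • N') ?_ (Submodule.zero_mem _)
      (fun x y _ _ hx hy => Submodule.add_mem _ hx hy) (fun k x _ hx => (I • N').toAddSubgroup.zsmul_mem hx k)
      (hΛN hC)
    rintro D ⟨a, ha, C₀, hC₀, rfl⟩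
    have hmem : (⟨a, Algebra.subset_adjoin ha⟩ : S) • C₀ ∈ I • N' :=
      Submodule.smul_mem_smul (show (⟨a, Algebra.subset_adjoin ha⟩ : S) ∈ I from ha) (show C₀ ∈ N' from hC₀)
    rw [hsmul] at hmem
    exact hmem
  obtain ⟨r, hr1, hr0⟩ := Submodule.exists_sub_one_mem_and_smul_eq_zero_of_fg_of_le_smul I N' hNfg hIN
  -- `r` acts as zero on the faithful `N`, so `r = 0` and `1 = -(r - 1) ∈ Λ`
  have hr : (r : A) = 0 := hfaith r fun C hC => by rw [← hsmul]; exact hr0 C hC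
  have h1 : ((r : A) - 1) ∈ Λ := hr1
  rw [hr, zero_sub] at h1
  simpa using Λ.neg_mem h1

/-! ## §3 Theorem 5.6 (c) (v) ⟹ (i) for every `A` -/

variable [Module.Finite ℚ A]

/-- **The heart of (v) ⟹ (i): `1_A ∈ L_1`.**  For an order-like `O` (`OO ⊆ O`, full) and a full `L_1 ⊆ O` with
`L_1² ⊆ L_1` (5.6) and `O : L_1 = O` (5.8): take a `ℤ`-basis `b` of `O`, so `O^{*ℤ} = ⊕ ℤbᵢ^*` is `L_1`-stable and
faithful; `K := L_1·O^{*ℤ}` satisfies `k·O^{*ℤ} ⊆ K ⊆ O^{*ℤ}` (`k·1_A ∈ L_1`), so it is a lattice of `A^*` with a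
`ℤ`-basis `b'`; its predual vectors `vᵢ` (`b'ᵢ^* = ev(vᵢ)`, `(V^*)^* = V`) lie in `O : L_1 = O` by (5.8), whence every
`C ∈ O^{*ℤ}` has integer `b'`-coordinates `C(vᵢ)`: `O^{*ℤ} ⊆ K` (5.7), and §2 gives `1_A ∈ L_1`.
[cite: HertlingLarabi2026, §5 Thm. 5.6 (c) proof of (v) ⟹ (i) ((5.6)–(5.8)) with §2 Lemma 2.3 (b), chunks p0012, p0005] -/
theorem one_mem_of_sq_le_of_div_eq {O L₁ : Submodule ℤ A} (hO : IsFullLattice A O) (hOO : O * O ≤ O)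
    (hL : IsFullLattice A L₁) (hL₁O : L₁ ≤ O) (h56 : L₁ * L₁ ≤ L₁) (h58 : O / L₁ = O) : (1 : A) ∈ L₁ := by
  -- a `ℤ`-basis `b` of `O`; `O^{*ℤ} = ⊕ ℤbᵢ^*`
  obtain ⟨b, hb⟩ := exists_basis_fin_span_eq hO
  have hN_iff : ∀ C : Module.Dual ℚ A, C ∈ span ℤ (Set.range b.dualBasis) ↔ ∀ x ∈ O, ∃ z : ℤ, (z : ℚ) = C x := by
    intro C
    rw [← hb]
    exact mem_span_dualBasis_iff b C
  have hO_iff : ∀ v : A, v ∈ O ↔ ∀ i, ∃ z : ℤ, (z : ℚ) = b.dualBasis i v := by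
    intro v
    rw [← hb]
    exact mem_span_iff_forall_dualBasis b v
  -- `O^{*ℤ}` is `O`-stable and faithful
  have hstabO : ∀ a ∈ O, ∀ C ∈ span ℤ (Set.range b.dualBasis),
      C ∘ₗ LinearMap.mulLeft ℚ a ∈ span ℤ (Set.range b.dualBasis) := by
    intro a ha C hC
    rw [hN_iff] at hC ⊢
    intro x hx
    rw [LinearMap.comp_apply, LinearMap.mulLeft_apply]
    exact hC (a * x) (hOO (Submodule.mul_mem_mul ha hx))
  have hfaith : ∀ r : A, (∀ C ∈ span ℤ (Set.range b.dualBasis), C ∘ₗ LinearMap.mulLeft ℚ r = 0) → r = 0 := by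
    intro r hr
    refine b.ext_elem fun i => ?_
    have h := LinearMap.congr_fun (hr (b.dualBasis i) (Submodule.subset_span (Set.mem_range_self i))) 1
    rw [LinearMap.comp_apply, LinearMap.mulLeft_apply, mul_one, Basis.dualBasis_apply, LinearMap.zero_apply] at h
    rw [h, map_zero, Finsupp.zero_apply]
  -- `K := L₁·O^{*ℤ} ⊆ O^{*ℤ}`, and `k·O^{*ℤ} ⊆ K` for `k·1_A ∈ L₁`
  have hKN : span ℤ {D : Module.Dual ℚ A | ∃ a ∈ L₁, ∃ C ∈ span ℤ (Set.range b.dualBasis),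
      D = C ∘ₗ LinearMap.mulLeft ℚ a} ≤ span ℤ (Set.range b.dualBasis) := by
    refine Submodule.span_le.2 ?_
    rintro D ⟨a, ha, C, hC, rfl⟩
    exact hstabO a (hL₁O ha) C hC
  obtain ⟨k, hk, hk1⟩ := hL.2 1
  have hkK : ∀ C ∈ span ℤ (Set.range b.dualBasis), k • C ∈ span ℤ {D : Module.Dual ℚ A | ∃ a ∈ L₁,
      ∃ C ∈ span ℤ (Set.range b.dualBasis), D = C ∘ₗ LinearMap.mulLeft ℚ a} := by
    intro C hC
    have e : k • C = C ∘ₗ LinearMap.mulLeft ℚ (k • (1 : A)) := LinearMap.ext fun x => by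
      rw [LinearMap.smul_apply, LinearMap.comp_apply, LinearMap.mulLeft_apply, smul_mul_assoc, one_mul, map_zsmul]
    rw [e]
    exact Submodule.subset_span ⟨_, hk1, C, hC, rfl⟩
  -- `K` is a lattice of `A^*`: a `ℤ`-basis `b'`
  haveI hKlat : (span ℤ {D : Module.Dual ℚ A | ∃ a ∈ L₁, ∃ C ∈ span ℤ (Set.range b.dualBasis),
      D = C ∘ₗ LinearMap.mulLeft ℚ a}).IsLattice ℚ := by
    refine ⟨Submodule.FG.of_le (Submodule.fg_span (Set.finite_range _)) hKN, eq_top_iff.2 ?_⟩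
    rw [← b.dualBasis.span_eq, Submodule.span_le]
    rintro _ ⟨i, rfl⟩
    have hmem := hkK _ (Submodule.subset_span (Set.mem_range_self i))
    have e : b.dualBasis i = (k : ℚ)⁻¹ • (k • b.dualBasis i) := by
      rw [← Int.cast_smul_eq_zsmul ℚ k, smul_smul, inv_mul_cancel₀ (Int.cast_ne_zero.2 hk), one_smul]
    rw [e]
    exact Submodule.smul_mem _ _ (Submodule.subset_span hmem)
  obtain ⟨b', hb'⟩ := QuadraticForms.SelfDualUpToScalar.exists_basis_span_eq_of_isLattice (K := ℚ)
    (span ℤ {D : Module.Dual ℚ A | ∃ a ∈ L₁, ∃ C ∈ span ℤ (Set.range b.dualBasis), D = C ∘ₗ LinearMap.mulLeft ℚ a})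
  -- the predual vectors `vᵢ` of `b'`: `D(vᵢ) = (b')ᵢ^*(D)` is the `i`-th coordinate of `D`
  have hv : ∀ (i) (D : Module.Dual ℚ A), D ((Module.evalEquiv ℚ A).symm (b'.dualBasis i)) = b'.repr D i :=
    fun i D => by rw [Module.apply_evalEquiv_symm_apply, Basis.dualBasis_apply]
  have hvK : ∀ i, ∀ D ∈ span ℤ {D : Module.Dual ℚ A | ∃ a ∈ L₁, ∃ C ∈ span ℤ (Set.range b.dualBasis),
      D = C ∘ₗ LinearMap.mulLeft ℚ a}, ∃ z : ℤ, (z : ℚ) = D ((Module.evalEquiv ℚ A).symm (b'.dualBasis i)) := by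
    intro i D hD
    rw [← hb'] at hD
    obtain ⟨z, hz⟩ := (Basis.mem_span_iff_repr_mem ℤ b' D).1 hD i
    exact ⟨z, by rw [hv, ← hz, eq_intCast]⟩
  -- (5.8): `vᵢ ∈ O : L₁ = O`
  have hvO : ∀ i, (Module.evalEquiv ℚ A).symm (b'.dualBasis i) ∈ O := by
    intro i
    rw [← h58, Submodule.mem_div_iff_forall_mul_mem]
    intro a ha
    rw [hO_iff]
    intro j
    obtain ⟨z, hz⟩ := hvK i (b.dualBasis j ∘ₗ LinearMap.mulLeft ℚ a)
      (Submodule.subset_span ⟨a, ha, _, Submodule.subset_span (Set.mem_range_self j), rfl⟩)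
    refine ⟨z, ?_⟩
    rw [hz, LinearMap.comp_apply, LinearMap.mulLeft_apply, mul_comm]
  -- (5.7): `O^{*ℤ} ⊆ K`
  have hNK : span ℤ (Set.range b.dualBasis) ≤ span ℤ {D : Module.Dual ℚ A | ∃ a ∈ L₁,
      ∃ C ∈ span ℤ (Set.range b.dualBasis), D = C ∘ₗ LinearMap.mulLeft ℚ a} := by
    intro C hC
    rw [← hb']
    refine (Basis.mem_span_iff_repr_mem ℤ b' C).2 fun i => ?_
    obtain ⟨z, hz⟩ := (hN_iff C).1 hC _ (hvO i)
    exact ⟨z, by rw [eq_intCast, hz, hv]⟩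
  -- Krull's lemma with the lattice `O^{*ℤ}` of `A^*`
  exact one_mem_of_mul_le_of_le_span_comp_mulLeft h56 (Submodule.fg_span (Set.finite_range _)) hfaith
    (fun a ha C hC => hstabO a (hL₁O ha) C hC) hNK

/-- **THEOREM 5.6 (c) (v) ⟹ (iii) [Fa65] = HL26b THEOREM 4.3 (b) (iv) ⟹ (iii), FOR EVERY finite-dimensional
commutative `ℚ`-algebra `A`: `𝒪(𝒪(L):L) = 𝒪(L)` implies `L·(𝒪(L):L) = 𝒪(L)`** — `L_1 := L(𝒪(L):L)` satisfies (5.6)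
`L_1² ⊂ L_1` and (5.8) `𝒪(L) : L_1 = 𝒪(L)`; then `1_A ∈ L_1` (`one_mem_of_sq_le_of_div_eq`, via `A^*`), so
`L_1 = 𝒪(L)L_1 = 𝒪(L)`. [cite: HertlingLarabi2026, §5 Thm. 5.6 (c) (v) ⟹ (i), chunk p0012]
[cite: HertlingLarabi2026b, §4 Thm. 4.3 (b) (iv) ⟹ (i), chunk p0007] [cite: Faddeev1965, as cited by HertlingLarabi2026 Thm. 5.6 (c)] -/
theorem mul_div_div_eq_of_div_div_div_eq_of_isFullLattice {M : Submodule ℤ A} (hM : IsFullLattice A M)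
    (hv : ((M / M) / M) / ((M / M) / M) = M / M) : M * ((M / M) / M) = M / M := by
  have hO : IsFullLattice A (M / M) := isFullLattice_div hM hM
  have hle : M * ((M / M) / M) ≤ M / M := mul_div_div_le M
  -- `𝒪(L)L_1 = L_1`
  have hOL : (M / M) * (M * ((M / M) / M)) = M * ((M / M) / M) := by
    rw [← mul_assoc, div_self_mul_eq_self]
  -- (5.6) `L_1² ⊂ L_1`
  have h56 : (M * ((M / M) / M)) * (M * ((M / M) / M)) ≤ M * ((M / M) / M) :=
    calc (M * ((M / M) / M)) * (M * ((M / M) / M)) ≤ (M / M) * (M * ((M / M) / M)) := mul_le_mul' hle le_rfl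
      _ = M * ((M / M) / M) := hOL
  -- (5.8) `𝒪(L) : L_1 = 𝒪(L)` (uses (v))
  have h58 : (M / M) / (M * ((M / M) / M)) = M / M := by
    refine le_antisymm (fun a ha => ?_) (Submodule.le_div_iff_mul_le.2 ?_)
    · rw [← hv, Submodule.mem_div_iff_forall_mul_mem]
      intro p hp
      rw [Submodule.mem_div_iff_forall_mul_mem]
      intro m hm
      rw [Submodule.mem_div_iff_forall_mul_mem] at ha
      have h1 := ha (m * p) (Submodule.mul_mem_mul hm hp)
      rwa [show a * (m * p) = a * p * m by ring] at h1
    · calc (M / M) * (M * ((M / M) / M)) ≤ (M / M) * (M / M) := mul_le_mul' le_rfl hle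
        _ = M / M := div_self_mul_div_self M
  -- `1 ∈ L_1`, so `L_1 = 𝒪(L)`
  have h1 : (1 : A) ∈ M * ((M / M) / M) :=
    one_mem_of_sq_le_of_div_eq hO (div_self_mul_div_self M).le (isFullLattice_mul hM (isFullLattice_div hO hM))
      hle h56 h58
  refine le_antisymm hle fun x hx => ?_
  rw [← hOL, ← mul_one x]
  exact Submodule.mul_mem_mul hx h1

/-- **THEOREM 5.6 (c) (iii) ⟺ (v) = HL26b THEOREM 4.3 (b) (iii) ⟺ (iv) for every `A`:
`L·(𝒪(L):L) = 𝒪(L) ⟺ 𝒪(𝒪(L):L) = 𝒪(L)`.** [cite: HertlingLarabi2026, §5 Thm. 5.6 (c), chunk p0012] [cite: HertlingLarabi2026b, §4 Thm. 4.3 (b), chunk p0007] -/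
theorem mul_div_div_eq_iff_div_div_div_eq_of_isFullLattice {M : Submodule ℤ A} (hM : IsFullLattice A M) :
    M * ((M / M) / M) = M / M ↔ ((M / M) / M) / ((M / M) / M) = M / M :=
  ⟨div_div_div_eq_of_mul_div_div_eq, mul_div_div_eq_of_div_div_div_eq_of_isFullLattice hM⟩

omit [Algebra ℚ A] [Module.Finite ℚ A] in
/-- **THEOREM 5.6 (c) (ii) ⟺ (iii): `L·L_2 = 𝒪(L)` for some `L_2` iff `L·(𝒪(L):L) = 𝒪(L)`** (any commutative ring).
[cite: HertlingLarabi2026, §5 Thm. 5.6 (c) (ii) ⟺ (iii), chunk p0012] -/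
theorem exists_mul_eq_div_self_iff_mul_div_div_eq {M : Submodule ℤ A} :
    (∃ L₂ : Submodule ℤ A, M * L₂ = M / M) ↔ M * ((M / M) / M) = M / M :=
  ⟨mul_div_div_eq_of_exists_mul_eq_div_self, fun h => ⟨_, h⟩⟩

omit [Algebra ℚ A] [Module.Finite ℚ A] in
/-- **«`L⁻¹ = 𝒪(L):L`, and `L⁻¹` is invertible with `𝒪(L⁻¹) = 𝒪(L)`»**: if `L·(𝒪(L):L) = 𝒪(L)` then
`(𝒪(L):L)·(𝒪(L):(𝒪(L):L)) = 𝒪(L)` (any commutative ring). [cite: HertlingLarabi2026, §5 Thm. 5.6 (c) (consequences), chunk p0012]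
[cite: HertlingLarabi2026b, §4 Thm. 4.3 (b) (last sentence), chunk p0007] -/
theorem div_div_mul_div_div_div_eq_of_mul_div_div_eq {M : Submodule ℤ A} (h : M * ((M / M) / M) = M / M) :
    ((M / M) / M) * ((M / M) / ((M / M) / M)) = M / M := by
  have hO : ((M / M) / M) / ((M / M) / M) = M / M := div_div_div_eq_of_mul_div_div_eq h
  have h2 := mul_div_div_eq_of_exists_mul_eq_div_self (M := (M / M) / M) ⟨M, by rw [hO, mul_comm, h]⟩
  rwa [hO] at h2

end Literature.NumberTheory.ComplexMultiplication.FiniteQAlgebraLattice
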